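import Literature.NumberTheory.DiophantineGeometry.BombieriPilaGraphCount
import HarnessLib

/-!
# Bombieri–Pila, Theorem 5: the proof

`bombieriPila_card_integralPointsInBox_le_holds` discharges the named fact
`Literature.NumberTheory.DiophantineGeometry.Dioph.bombieriPila_card_integralPointsInBox_le` of
`Literature/NumberTheory/DiophantineGeometry/BombieriPila.lean` (E. Bombieri, J. Pila,
*The number of integral points on arcs and ovals*, Duke Math. J. 59 (1989) 337–357, Theorem 5,
in its `N^{1/d+ε}` form), by assembling (`bombieriPila_card_integralPointsInBox_le_of_steps`,
file `BombieriPilaSteps`) the two ingredients of the printed proof: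

* `bombieriPila_graph_card_le_holds` (Theorem 4 in `N^{1/d+ε}` form; file
  `BombieriPilaGraphCount`, through the Generalized Main Lemma `generalizedMainLemma` of file
  `BombieriPilaMainLemma`, the interpolation determinant bound of file
  `InterpolationDeterminant`, implicit differentiation and translations of file
  `BombieriPilaImplicitDerivatives`, and the weak Bézout bound of file `PlaneCurveBezoutWeak`);
* `bombieriPila_curve_subset_branches_holds` (the branch decomposition of the real curve; file
  `RealPlaneCurveBranches`).

## References

* E. Bombieri, J. Pila, *The number of integral points on arcs and ovals*, Duke Math. J. 59
  (1989) 337–357 [BombieriPila1989].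
-/

namespace Literature.NumberTheory.DiophantineGeometry.Dioph

/-- **Bombieri–Pila (1989), Theorem 5** (uniform `N^{1/d+ε}` bound for the integral points of
an absolutely irreducible plane curve of degree `d` in a box): the named fact
`bombieriPila_card_integralPointsInBox_le` holds. [cite: BombieriPila1989, Theorem 5] -/
theorem bombieriPila_card_integralPointsInBox_le_holds : bombieriPila_card_integralPointsInBox_le :=
  bombieriPila_card_integralPointsInBox_le_of_steps bombieriPila_graph_card_le_holds
    bombieriPila_curve_subset_branches_holds

end Literature.NumberTheory.DiophantineGeometry.Dioph
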